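import Summits.KontsevichZagierPeriods.KontsevichZagierPeriods.Theses.AbelContraction

/-!
# Route AbelContraction — `Assembly` (item stmt-KontsevichZagierPeriods-12478)

Pure-logic assembly of route AbelContraction:
`GenusTwoContraction → HyperellipticMContraction → RealHyperellipticSector → RealArcKernel →
KontsevichZagierPeriods`.

Only the last two hypotheses are consumed (exactly as in the route's deciding theorem `closes`):
the enlarged-kernel target `RealArcKernel` is applied at `R := KZ.relations`; its sector
hypothesis — every value-`0` combination of the one-curve real hyperelliptic sector lies in `R` —
is supplied by the programme crux `RealHyperellipticSector` (which puts them in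
`KZ.relationsLE 1 ≤ KZ.relations`, `KZ.relationsLE_le_relations`). Hence `ker KZ.eval ≤
KZ.relations`, and for two rational-shape representations `r, r'` of equal value
`KZ.eval ([r] − [r']) = r.value − r'.value = 0`, so `[r] − [r'] ∈ KZ.relations`, i.e.
`KZ.Equivalent r r'`. The engine items `GenusTwoContraction`, `HyperellipticMContraction` are
special cases of the programme's relators and do not enter the implication.
-/

namespace Summit.KontsevichZagierPeriods.AbelContraction

open Literature.NumberTheory.Transcendental

/-- **Assembly** (item stmt-KontsevichZagierPeriods-12478 of route AbelContraction):
`GenusTwoContraction → HyperellipticMContraction → RealHyperellipticSector → RealArcKernel →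
KontsevichZagierPeriods`.
Pure logic: `RealArcKernel` at `R := KZ.relations`, its sector hypothesis fed by
`RealHyperellipticSector` through `KZ.relationsLE 1 ≤ KZ.relations`, gives
`ker KZ.eval ≤ KZ.relations`; two representations of equal value have
`KZ.eval ([r] − [r']) = 0` (`KZ.eval_of`), hence are `KZ.Equivalent`. The two engine hypotheses
are not used. [Kontsevich–Zagier 2001, §1.2] [folklore] -/
theorem assembly_proof :
    Summit.KontsevichZagierPeriods.KontsevichZagierPeriods.Theses.AbelContraction.Assembly := by
  unfold Summit.KontsevichZagierPeriods.KontsevichZagierPeriods.Theses.AbelContraction.Assembly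
  intro _h₁ _h₂ h₃ h₄ n m r r' _hr _hr' hv
  refine h₄ KZ.relations le_rfl
    (fun q x hx hx0 => KZ.relationsLE_le_relations 1 (h₃ q x hx hx0)) _ ?_
  simp [KZ.eval_of, hv]

end Summit.KontsevichZagierPeriods.AbelContraction
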